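import Mathlib
import Summits.MatrixMultiplication.MatrixMultiplication.Theorems.SubgroupIdentityDesigns.Negative.FibreGhost

/-!
# Right orbit pairs: the row-vector form of the orbit-pair certificate (all `p`)

Route `LevelGradedCohnUmans`, crux `SubgroupIdentityDesigns`, the `(m,k) = (2,1)` cell, `p`-free
case.  `OrbitPair` compares `Σ_K F(k)` with the LEFT translate `Σ_K F(k₀ k)`.  Since
`tr((a bᵀ) k k₀) = b ⬝ k (k₀ a)`, a level-`1` function summed over the RIGHT translate `K k₀` is
controlled by the vectors `k (k₀ a)`: if for every `a ≠ 0` some bijection `e : K ≃ K` has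
`(e k)(k₀ a) = k a` (a RIGHT ORBIT PAIR), then `Σ_K F(k) = Σ_K F(k k₀)`
(`sum_fourier_eq_of_orbit_pair_right`) and, with `1 ∈ K`, `K k₀ ∌ 1` and `K ∖ {1}`, `K k₀` inside
the triple-product set, the level-`1` identity design is impossible
(`no_levelOne_design_of_orbit_pair_right`).  For a subgroup `K` acting freely and transitively on
non-zero vectors (a full Singer cycle) every `k₀` qualifies (`orbitPairRight_of_transitive`),
whence `no_levelOne_design_of_transitive₁₂/₁₃/₂₃`: `K ≤ H₁` (resp. `H₁`, `H₂`) and a non-trivial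
`k₀ ∉ K` in `H₂` (resp. `H₃`, `H₃`) exclude the design — completing, with `TransitiveTorus` (`₂₁/₃₁/₃₂`), all six
cross-member placements.  All `p`; no TPP, no volume hypothesis.  VALUE = THEOREM, NOT summit
progress; the crux item stmt-MatrixMultiplication-14079 is untouched and remains open.
-/

set_option linter.dupNamespace false

noncomputable section

open scoped BigOperators Classical

open Summit.MatrixMultiplication.MatrixMultiplication.Theorems.LieRankDesigns.Negative (GLm Mat)

namespace Summit.MatrixMultiplication.MatrixMultiplication.Theorems.SubgroupIdentityDesigns.Negative

section OrbitPairRight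

variable {p : ℕ} [hp : Fact p.Prime]

/-- **Right orbit pairs preserve level-one sums**: `Σ_{k ∈ K} F(k) = Σ_{k ∈ K} F(k k₀)`. -/
theorem sum_fourier_eq_of_orbit_pair_right (c : Mat p 2 → ℂ)
    (hc : ∀ M : Mat p 2, 1 < M.rank → c M = 0) (K : Finset (GLm p 2)) (k₀ : GLm p 2)
    (horb : ∀ a : Fin 2 → ZMod p, a ≠ 0 → ∃ e : K ≃ K, ∀ k : K,
      ((e k : GLm p 2) : Mat p 2).mulVec (((k₀ : GLm p 2) : Mat p 2).mulVec a) =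
        ((k : GLm p 2) : Mat p 2).mulVec a) :
    ∑ k ∈ K, ∑ M : Mat p 2, c M * ZMod.stdAddChar (Matrix.trace (M * ((k : GLm p 2) : Mat p 2))) =
      ∑ k ∈ K, ∑ M : Mat p 2,
        c M * ZMod.stdAddChar (Matrix.trace (M * ((k * k₀ : GLm p 2) : Mat p 2))) := by
  rw [Finset.sum_comm, Finset.sum_comm (s := K)]
  refine Finset.sum_congr rfl fun M _ => ?_
  rw [← Finset.mul_sum, ← Finset.mul_sum]
  by_cases hcM : c M = 0
  · rw [hcM, zero_mul, zero_mul]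
  have hM : M.rank ≤ 1 := by
    by_contra h
    exact hcM (hc M (by omega))
  by_cases hM0 : M = 0
  · subst hM0
    simp
  obtain ⟨a, b, ha, rfl⟩ := exists_vecMulVec_of_rank_le_one M hM hM0
  congr 1
  simp_rw [trace_vecMulVec_mul, Units.val_mul, ← Matrix.mulVec_mulVec]
  obtain ⟨e, he⟩ := horb a ha
  rw [← Finset.sum_coe_sort K, ← Finset.sum_coe_sort K]
  calc ∑ k : K, ZMod.stdAddChar (b ⬝ᵥ ((k : GLm p 2) : Mat p 2).mulVec a)
      = ∑ k : K, ZMod.stdAddChar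
          (b ⬝ᵥ ((e k : GLm p 2) : Mat p 2).mulVec (((k₀ : GLm p 2) : Mat p 2).mulVec a)) :=
        Finset.sum_congr rfl fun k _ => by rw [he k]
    _ = ∑ k : K, ZMod.stdAddChar
          (b ⬝ᵥ ((k : GLm p 2) : Mat p 2).mulVec (((k₀ : GLm p 2) : Mat p 2).mulVec a)) :=
        Equiv.sum_comp e (fun k : K => ZMod.stdAddChar
          (b ⬝ᵥ ((k : GLm p 2) : Mat p 2).mulVec (((k₀ : GLm p 2) : Mat p 2).mulVec a)))

/-- **No level-one identity design from a RIGHT orbit pair** supported on the triple products. -/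
theorem no_levelOne_design_of_orbit_pair_right {H₁ H₂ H₃ : Subgroup (GLm p 2)}
    (K : Finset (GLm p 2)) (k₀ : GLm p 2) (h1 : (1 : GLm p 2) ∈ K) (hk1 : ∀ k ∈ K, k * k₀ ≠ 1)
    (hmem : ∀ k ∈ K, k ≠ 1 → ∃ a ∈ H₁, ∃ b ∈ H₂, ∃ g ∈ H₃, a * b * g = k)
    (hmem' : ∀ k ∈ K, ∃ a ∈ H₁, ∃ b ∈ H₂, ∃ g ∈ H₃, a * b * g = k * k₀)
    (horb : ∀ a : Fin 2 → ZMod p, a ≠ 0 → ∃ e : K ≃ K, ∀ k : K,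
      ((e k : GLm p 2) : Mat p 2).mulVec (((k₀ : GLm p 2) : Mat p 2).mulVec a) =
        ((k : GLm p 2) : Mat p 2).mulVec a) :
    ¬ ∃ c : Mat p 2 → ℂ, (∀ M, 1 < M.rank → c M = 0) ∧
      (∑ M, c M * ZMod.stdAddChar (Matrix.trace (M * ((1 : GLm p 2) : Mat p 2)))) = 1 ∧
      ∀ a ∈ H₁, ∀ b ∈ H₂, ∀ g ∈ H₃, a * b * g ≠ 1 →
        (∑ M, c M *
          ZMod.stdAddChar (Matrix.trace (M * ((a * b * g : GLm p 2) : Mat p 2)))) = 0 := by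
  rintro ⟨c, hc, hc1, hc0⟩
  have hsum := sum_fourier_eq_of_orbit_pair_right c hc K k₀ horb
  have hL : ∑ k ∈ K, ∑ M : Mat p 2,
      c M * ZMod.stdAddChar (Matrix.trace (M * ((k : GLm p 2) : Mat p 2))) = 1 := by
    rw [Finset.sum_eq_single_of_mem 1 h1]
    · exact hc1
    · intro k hk hk1'
      obtain ⟨a, ha, b, hb, g, hg, e⟩ := hmem k hk hk1'
      rw [← e]
      exact hc0 a ha b hb g hg (by rw [e]; exact hk1')
  have hR : ∑ k ∈ K, ∑ M : Mat p 2,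
      c M * ZMod.stdAddChar (Matrix.trace (M * ((k * k₀ : GLm p 2) : Mat p 2))) = 0 := by
    refine Finset.sum_eq_zero fun k hk => ?_
    obtain ⟨a, ha, b, hb, g, hg, e⟩ := hmem' k hk
    rw [← e]
    exact hc0 a ha b hb g hg (by rw [e]; exact hk1 k hk)
  rw [hL, hR] at hsum
  exact one_ne_zero hsum

/-- **Free + transitive ⇒ right orbit pair with ANY `k₀`.** -/
theorem orbitPairRight_of_transitive (K : Subgroup (GLm p 2)) (k₀ : GLm p 2)
    (hfree : ∀ a : Fin 2 → ZMod p, a ≠ 0 → ∀ k ∈ K, ∀ k' ∈ K,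
      ((k : GLm p 2) : Mat p 2).mulVec a = ((k' : GLm p 2) : Mat p 2).mulVec a → k = k')
    (htrans : ∀ a : Fin 2 → ZMod p, a ≠ 0 → ∀ v : Fin 2 → ZMod p, v ≠ 0 → ∃ k ∈ K,
      ((k : GLm p 2) : Mat p 2).mulVec a = v)
    (a : Fin 2 → ZMod p) (ha : a ≠ 0) :
    ∃ e : (K : Set (GLm p 2)).toFinset ≃ (K : Set (GLm p 2)).toFinset,
      ∀ k : (K : Set (GLm p 2)).toFinset,
        ((e k : GLm p 2) : Mat p 2).mulVec (((k₀ : GLm p 2) : Mat p 2).mulVec a) =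
          ((k : GLm p 2) : Mat p 2).mulVec a := by
  set KF := (K : Set (GLm p 2)).toFinset with hKF
  have hmem : ∀ {k : GLm p 2}, k ∈ KF ↔ k ∈ K := fun {k} => by
    rw [hKF, Set.mem_toFinset]; rfl
  have ha' : ((k₀ : GLm p 2) : Mat p 2).mulVec a ≠ 0 := by
    intro h0
    apply ha
    have := congrArg ((k₀⁻¹ : GLm p 2) : Mat p 2).mulVec h0
    rwa [Matrix.mulVec_mulVec, Matrix.mulVec_zero, ← Units.val_mul, inv_mul_cancel, Units.val_one,
      Matrix.one_mulVec] at this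
  have hch : ∀ k : KF, ∃ k' : KF,
      ((k' : GLm p 2) : Mat p 2).mulVec (((k₀ : GLm p 2) : Mat p 2).mulVec a) =
        ((k : GLm p 2) : Mat p 2).mulVec a := fun k => by
    have hv : ((k : GLm p 2) : Mat p 2).mulVec a ≠ 0 := by
      intro h0
      apply ha
      have := congrArg (((k : GLm p 2)⁻¹ : GLm p 2) : Mat p 2).mulVec h0
      rwa [Matrix.mulVec_mulVec, Matrix.mulVec_zero, ← Units.val_mul, inv_mul_cancel,
        Units.val_one, Matrix.one_mulVec] at this
    obtain ⟨k', hk', e⟩ := htrans _ ha' _ hv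
    exact ⟨⟨k', hmem.mpr hk'⟩, e⟩
  choose f hf using hch
  have hinj : Function.Injective f := by
    intro k₁ k₂ h
    have e₁ := hf k₁
    have e₂ := hf k₂
    rw [h] at e₁
    exact Subtype.ext (hfree a ha _ (hmem.mp k₁.2) _ (hmem.mp k₂.2) (e₁.symm.trans e₂))
  exact ⟨Equiv.ofBijective f (Finite.injective_iff_bijective.mp hinj), fun k => hf k⟩

/-- **`K ≤ H₁` free and transitive, `k₀ ∈ H₂ ∖ K` ⇒ no level-one identity design.** -/
theorem no_levelOne_design_of_transitive₁₂ {H₁ H₂ H₃ : Subgroup (GLm p 2)}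
    (K : Subgroup (GLm p 2)) (hKH : K ≤ H₁) (k₀ : GLm p 2) (hk₀ : k₀ ∈ H₂) (hk₀K : k₀ ∉ K)
    (hfree : ∀ a : Fin 2 → ZMod p, a ≠ 0 → ∀ k ∈ K, ∀ k' ∈ K,
      ((k : GLm p 2) : Mat p 2).mulVec a = ((k' : GLm p 2) : Mat p 2).mulVec a → k = k')
    (htrans : ∀ a : Fin 2 → ZMod p, a ≠ 0 → ∀ v : Fin 2 → ZMod p, v ≠ 0 → ∃ k ∈ K,
      ((k : GLm p 2) : Mat p 2).mulVec a = v) :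
    ¬ ∃ c : Mat p 2 → ℂ, (∀ M, 1 < M.rank → c M = 0) ∧
      (∑ M, c M * ZMod.stdAddChar (Matrix.trace (M * ((1 : GLm p 2) : Mat p 2)))) = 1 ∧
      ∀ a ∈ H₁, ∀ b ∈ H₂, ∀ g ∈ H₃, a * b * g ≠ 1 →
        (∑ M, c M *
          ZMod.stdAddChar (Matrix.trace (M * ((a * b * g : GLm p 2) : Mat p 2)))) = 0 := by
  have hmem : ∀ {k : GLm p 2}, k ∈ (K : Set (GLm p 2)).toFinset ↔ k ∈ K := fun {k} => by
    rw [Set.mem_toFinset]; rfl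
  refine no_levelOne_design_of_orbit_pair_right (K : Set (GLm p 2)).toFinset k₀
    (hmem.mpr K.one_mem) (fun k hk e => hk₀K ?_)
    (fun k hk _ => ⟨k, hKH (hmem.mp hk), 1, H₂.one_mem, 1, H₃.one_mem, by rw [mul_one, mul_one]⟩)
    (fun k hk => ⟨k, hKH (hmem.mp hk), k₀, hk₀, 1, H₃.one_mem, by rw [mul_one]⟩)
    (orbitPairRight_of_transitive K k₀ hfree htrans)
  rw [eq_inv_of_mul_eq_one_right e]
  exact K.inv_mem (hmem.mp hk)

/-- **`K ≤ H₁` free and transitive, `k₀ ∈ H₃ ∖ K` ⇒ no level-one identity design.** -/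
theorem no_levelOne_design_of_transitive₁₃ {H₁ H₂ H₃ : Subgroup (GLm p 2)}
    (K : Subgroup (GLm p 2)) (hKH : K ≤ H₁) (k₀ : GLm p 2) (hk₀ : k₀ ∈ H₃) (hk₀K : k₀ ∉ K)
    (hfree : ∀ a : Fin 2 → ZMod p, a ≠ 0 → ∀ k ∈ K, ∀ k' ∈ K,
      ((k : GLm p 2) : Mat p 2).mulVec a = ((k' : GLm p 2) : Mat p 2).mulVec a → k = k')
    (htrans : ∀ a : Fin 2 → ZMod p, a ≠ 0 → ∀ v : Fin 2 → ZMod p, v ≠ 0 → ∃ k ∈ K,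
      ((k : GLm p 2) : Mat p 2).mulVec a = v) :
    ¬ ∃ c : Mat p 2 → ℂ, (∀ M, 1 < M.rank → c M = 0) ∧
      (∑ M, c M * ZMod.stdAddChar (Matrix.trace (M * ((1 : GLm p 2) : Mat p 2)))) = 1 ∧
      ∀ a ∈ H₁, ∀ b ∈ H₂, ∀ g ∈ H₃, a * b * g ≠ 1 →
        (∑ M, c M *
          ZMod.stdAddChar (Matrix.trace (M * ((a * b * g : GLm p 2) : Mat p 2)))) = 0 := by
  have hmem : ∀ {k : GLm p 2}, k ∈ (K : Set (GLm p 2)).toFinset ↔ k ∈ K := fun {k} => by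
    rw [Set.mem_toFinset]; rfl
  refine no_levelOne_design_of_orbit_pair_right (K : Set (GLm p 2)).toFinset k₀
    (hmem.mpr K.one_mem) (fun k hk e => hk₀K ?_)
    (fun k hk _ => ⟨k, hKH (hmem.mp hk), 1, H₂.one_mem, 1, H₃.one_mem, by rw [mul_one, mul_one]⟩)
    (fun k hk => ⟨k, hKH (hmem.mp hk), 1, H₂.one_mem, k₀, hk₀, by rw [mul_one]⟩)
    (orbitPairRight_of_transitive K k₀ hfree htrans)
  rw [eq_inv_of_mul_eq_one_right e]
  exact K.inv_mem (hmem.mp hk)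

/-- **`K ≤ H₂` free and transitive, `k₀ ∈ H₃ ∖ K` ⇒ no level-one identity design.** -/
theorem no_levelOne_design_of_transitive₂₃ {H₁ H₂ H₃ : Subgroup (GLm p 2)}
    (K : Subgroup (GLm p 2)) (hKH : K ≤ H₂) (k₀ : GLm p 2) (hk₀ : k₀ ∈ H₃) (hk₀K : k₀ ∉ K)
    (hfree : ∀ a : Fin 2 → ZMod p, a ≠ 0 → ∀ k ∈ K, ∀ k' ∈ K,
      ((k : GLm p 2) : Mat p 2).mulVec a = ((k' : GLm p 2) : Mat p 2).mulVec a → k = k')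
    (htrans : ∀ a : Fin 2 → ZMod p, a ≠ 0 → ∀ v : Fin 2 → ZMod p, v ≠ 0 → ∃ k ∈ K,
      ((k : GLm p 2) : Mat p 2).mulVec a = v) :
    ¬ ∃ c : Mat p 2 → ℂ, (∀ M, 1 < M.rank → c M = 0) ∧
      (∑ M, c M * ZMod.stdAddChar (Matrix.trace (M * ((1 : GLm p 2) : Mat p 2)))) = 1 ∧
      ∀ a ∈ H₁, ∀ b ∈ H₂, ∀ g ∈ H₃, a * b * g ≠ 1 →
        (∑ M, c M *
          ZMod.stdAddChar (Matrix.trace (M * ((a * b * g : GLm p 2) : Mat p 2)))) = 0 := by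
  have hmem : ∀ {k : GLm p 2}, k ∈ (K : Set (GLm p 2)).toFinset ↔ k ∈ K := fun {k} => by
    rw [Set.mem_toFinset]; rfl
  refine no_levelOne_design_of_orbit_pair_right (K : Set (GLm p 2)).toFinset k₀
    (hmem.mpr K.one_mem) (fun k hk e => hk₀K ?_)
    (fun k hk _ => ⟨1, H₁.one_mem, k, hKH (hmem.mp hk), 1, H₃.one_mem, by rw [one_mul, mul_one]⟩)
    (fun k hk => ⟨1, H₁.one_mem, k, hKH (hmem.mp hk), k₀, hk₀, by rw [one_mul]⟩)
    (orbitPairRight_of_transitive K k₀ hfree htrans)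
  rw [eq_inv_of_mul_eq_one_right e]
  exact K.inv_mem (hmem.mp hk)

end OrbitPairRight

end Summit.MatrixMultiplication.MatrixMultiplication.Theorems.SubgroupIdentityDesigns.Negative

end
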